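import Summits.NavierStokesRegularity.NavierStokesRegularity.Theorems.RootDecompLiouvilleHorizonKills
import HarnessLib

/-!
# Route `RootDecompLiouvilleHorizon` (N22): K1 `HorizonRecordKill` (item stmt-NavierStokesRegularity-32318) — closing link

The proof is `Theorems.RootDecompLiouvilleHorizonKills.horizonRecordKill_proof` (landed with K2's workitem;
one proposal carries one `--workitem`); this file is the by-name closing link for K1's item.
-/

set_option linter.dupNamespace false

namespace Summit.NavierStokesRegularity.NavierStokesRegularity.Theorems.RootDecompLiouvilleHorizonRecordKill

/-- **K1 `HorizonRecordKill`, item stmt-NavierStokesRegularity-32318**: Q♭ `BlowupHorizon` and the residual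
E♯ `NoRecordEulerianTypeII` make every maximal smooth Leray–Hopf blow-up of the frame Type I
(`RootDecompLiouvilleHorizonKills.horizonRecordKill_proof`). [cite: KochNadirashviliSereginSverak2009, §6] -/
theorem horizonRecordKill_holds :
    Summit.NavierStokesRegularity.NavierStokesRegularity.Theses.RootDecompLiouvilleHorizon.HorizonRecordKill :=
  RootDecompLiouvilleHorizonKills.horizonRecordKill_proof

end Summit.NavierStokesRegularity.NavierStokesRegularity.Theorems.RootDecompLiouvilleHorizonRecordKill
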